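import Summits.AtomisticToContinuum.BoseEinsteinCondensation.Theorems.BECGroundStateSOSPeriodicIRBoundDefs
import Summits.AtomisticToContinuum.BoseEinsteinCondensation.Theorems.BECGroundStateSOSPeriodicIRBoundWFDefs
import Summits.AtomisticToContinuum.BoseEinsteinCondensation.Theorems.BECGroundStateSOSPeriodicIRBoundWFFormBounds
import Summits.AtomisticToContinuum.BoseEinsteinCondensation.Theorems.BECGroundStateSOSPeriodicIRBoundWFRegularity
import Literature.MathematicalPhysics.QuantumManyBody.TorusFockLayer
import Literature.MathematicalPhysics.QuantumManyBody.PeriodicBoseGasRelabelling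
import Literature.MathematicalPhysics.QuantumManyBody.PeriodicFormDomain
import Mathlib.Algebra.Order.Chebyshev
import HarnessLib

/-! # Crux `PeriodicIRBound` (stmt-AtomisticToContinuum-3972), line `linear-ph-floor-wagner`, stub 5b `stub_wagnerFeynman` — FormBounds2
Crude a priori bounds, part 2: `𝓔[a_kΨ] ≤ (n+1)𝓔[Ψ]` (B8) and `𝓔[a_k†Φ] ≤ (n+1)(𝓔[Φ] + (|2πk/L|² + n‖w‖₁/L³)‖Φ‖²)` (B9). -/

/-!
# Form-boundedness of `a(φ)` and `a†(φ)`, part 2: the kinetic halves, B8 and B9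

`qform w L f = ∫_{cell} (|∇f|² + W|f|²)`:

* `qform_modeAn_le` : `𝓔_n[aΨ] ≤ (n+1) 𝓔_{n+1}[Ψ]` (kinetic half `lintegral_kineticDensity_modeAn_le`:
  `∂_{i,c}(aΨ)(Y) = √(n+1) ∫ conj φ ∂_{i+1,c}Ψ(x, Y) dx` and Bessel in `x`, the gradient in the
  contracted particle dropped; potential half `potForm_modeAn_le` of part 1);
* `qform_modeCr_le` : `𝓔_{n+1}[a†Φ] ≤ (n+1)(𝓔_n[Φ] + (‖p‖² + n‖w‖₁/L³)‖Φ‖²)`, `p = latticeVec (2π/L) k`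
  (kinetic half `lintegral_kineticDensity_modeCr_le`: the derivative of `a†Φ` by the product and
  chain rules, `fderiv_modeCr_apply`, Cauchy–Schwarz on its `n+1` terms — for `∂_{i,c}` the term
  `j = i` is `∂_cφ(x_i)Φ(X̂_i)` with `∑_c|∂_cφ|² = L⁻³‖p‖²`, the terms `j ≠ i` are `φ(x_j)∂_{i',c}Φ(X̂_j)` —
  and `∫_X G(X̂_j) = L³∫_Y G`; potential half `potForm_modeCr_le` of part 1). The constant is exactly
  the plan's.

DEPENDENCY: this file continues `WFFormBounds.lean` (part 1, same namespace) and uses its public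
lemmas `qform_eq_lintegral_kineticDensity_add_potForm`, `nnnorm_sq_integral_conj_planeWaveMode_mul_le`,
`measurable_kineticDensity_fb`, `nnnorm_sum_sq_le`, `cast_succ_mul_nnnorm_inv_sqrt_mul_sq`,
`coe_nnnorm_planeWaveMode_sq`, `lintegral_cellN_comp_removeNth`, `potForm_modeAn_le`,
block is replaced by importing `WFRegularity`. The real verification is the elaboration of the
-/

noncomputable section

open scoped BigOperators ENNReal ComplexConjugate
open Filter MeasureTheory

namespace Summit.AtomisticToContinuum.BoseEinsteinCondensation.Cruxes.PeriodicIRBound.LinearPhFloorWagner.WF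

open Literature.MathematicalPhysics.QuantumManyBody.BoseGas

variable {M m n : ℕ} {L : ℝ}

-- identical to the copy in part 1 — delete together with the RESTATED block once part 1 is imported)

-- the landed part-1 module). Exact signatures of part 1.

-- `WFRegularity` module, which proves `fderiv_modeAn_single` with this exact signature.

/-! ## The kinetic half of B8 and B8 -/

/-- Pointwise kinetic bound for `aΨ`: `|∇(aΨ)(Y)|² ≤ (n+1) ∫_cell |∇Ψ(x, Y)|² dx` (Bessel in the
contracted particle for each partial derivative `∂_{i+1,c}Ψ`, the gradient in the contracted
particle dropped). [folklore] -/
theorem kineticDensity_modeAn_le (hL : 0 < L) (k : Fin 3 → ℤ) {Ψ : Config (n + 1) → ℂ}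
    (hΨ : ContDiff ℝ 1 Ψ) (Y : Config n) :
    kineticDensity (modeAn L (planeWaveMode L k) Ψ) Y ≤
      (n + 1 : ℝ≥0∞) * ∫⁻ x in cell L, kineticDensity Ψ (Matrix.vecCons x Y) := by
  have hD : ∀ v : Config (n + 1), Continuous fun x : Space => fderiv ℝ Ψ (Matrix.vecCons x Y) v :=
    fun v => ((hΨ.continuous_fderiv one_ne_zero).comp
      (continuous_id.matrixVecCons continuous_const)).clm_apply continuous_const
  have hmeas : ∀ v : Config (n + 1), Measurable fun x : Space =>
      ((‖fderiv ℝ Ψ (Matrix.vecCons x Y) v‖₊ : ℝ≥0∞)) ^ 2 := fun v =>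
    ((hD v).measurable.nnnorm.coe_nnreal_ennreal).pow_const _
  have h1 : ∀ (i : Fin n) (c : Fin 3), ((‖fderiv ℝ (modeAn L (planeWaveMode L k) Ψ) Y
      (Pi.single i (EuclideanSpace.single c (1 : ℝ)))‖₊ : ℝ≥0∞)) ^ 2 ≤
        (n + 1 : ℝ≥0∞) * ∫⁻ x in cell L, ((‖fderiv ℝ Ψ (Matrix.vecCons x Y)
          (Pi.single i.succ (EuclideanSpace.single c (1 : ℝ)))‖₊ : ℝ≥0∞)) ^ 2 := by
    intro i c
    rw [fderiv_modeAn_single L (continuous_planeWaveMode L k) hΨ, nnnorm_sqrt_mul_sq]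
    exact mul_le_mul_right (nnnorm_sq_integral_conj_planeWaveMode_mul_le hL k (hD _)) _
  calc kineticDensity (modeAn L (planeWaveMode L k) Ψ) Y
      ≤ ∑ i : Fin n, ∑ c : Fin 3, (n + 1 : ℝ≥0∞) * ∫⁻ x in cell L, ((‖fderiv ℝ Ψ (Matrix.vecCons x Y)
          (Pi.single i.succ (EuclideanSpace.single c (1 : ℝ)))‖₊ : ℝ≥0∞)) ^ 2 :=
        Finset.sum_le_sum fun i _ => Finset.sum_le_sum fun c _ => h1 i c
    _ = (n + 1 : ℝ≥0∞) * ∫⁻ x in cell L, ∑ i : Fin n, ∑ c : Fin 3, ((‖fderiv ℝ Ψ (Matrix.vecCons x Y)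
          (Pi.single i.succ (EuclideanSpace.single c (1 : ℝ)))‖₊ : ℝ≥0∞)) ^ 2 := by
        rw [lintegral_finsetSum _ fun i _ => Finset.measurable_sum _ fun c _ => hmeas _,
          Finset.mul_sum]
        refine Finset.sum_congr rfl fun i _ => ?_
        rw [lintegral_finsetSum _ fun c _ => hmeas _, Finset.mul_sum]
    _ ≤ (n + 1 : ℝ≥0∞) * ∫⁻ x in cell L, kineticDensity Ψ (Matrix.vecCons x Y) := by
        refine mul_le_mul_right (lintegral_mono fun x => ?_) _
        rw [kineticDensity, Fin.sum_univ_succ]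
        exact le_add_self

/-- **Kinetic half of B8**: `∫|∇(aΨ)|² ≤ (n+1) ∫|∇Ψ|²` for a `C¹` `(n+1)`-body `Ψ`. [folklore] -/
theorem lintegral_kineticDensity_modeAn_le (hL : 0 < L) (k : Fin 3 → ℤ) {Ψ : Config (n + 1) → ℂ}
    (hΨ : ContDiff ℝ 1 Ψ) :
    ∫⁻ Y in cellN n L, kineticDensity (modeAn L (planeWaveMode L k) Ψ) Y ≤
      (n + 1 : ℝ≥0∞) * ∫⁻ X in cellN (n + 1) L, kineticDensity Ψ X := by
  rw [lintegral_cellN_succ L (measurable_kineticDensity_fb Ψ), ← lintegral_const_mul' _ _ (by simp)]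
  exact lintegral_mono fun Y => kineticDensity_modeAn_le hL k hΨ Y

/-- B8: form-boundedness of `a`: `𝓔_n[aΨ] ≤ (n+1) 𝓔_{n+1}[Ψ]` (Cauchy–Schwarz in the contracted variable,
`∫_cell|φ|² = 1`, `W_n(Y) ≤ W_{n+1}(x::Y)`). -/
theorem qform_modeAn_le (hL : 0 < L) {w : ℝ → ℝ≥0∞} (hw : Measurable w) (k : Fin 3 → ℤ)
    {Ψ : Config (n + 1) → ℂ} (hΨ : IsCore L Ψ) :
    qform w L (modeAn L (planeWaveMode L k) Ψ) ≤ (n + 1 : ℝ≥0∞) * qform w L Ψ := by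
  rw [qform_eq_lintegral_kineticDensity_add_potForm, qform_eq_lintegral_kineticDensity_add_potForm,
    mul_add]
  exact add_le_add (lintegral_kineticDensity_modeAn_le hL k hΨ.contDiff)
    (potForm_modeAn_le hL hw k hΨ.contDiff.continuous)

/-! ## The kinetic half of B9 and B9 -/

/-- Dropping particle `j`, `X ↦ X̂_j = removeNth j X`, as a continuous linear map. [folklore] -/
def removeNthCLM (j : Fin (n + 1)) : Config (n + 1) →L[ℝ] Config n :=
  ContinuousLinearMap.pi fun i => ContinuousLinearMap.proj (j.succAbove i)

/-- `removeNthCLM j X = X̂_j`. [folklore] -/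
@[simp]
theorem removeNthCLM_apply (j : Fin (n + 1)) (X : Config (n + 1)) :
    removeNthCLM j X = j.removeNth X :=
  rfl

/-- Dropping particle `j` kills a displacement of particle `j`. [folklore] -/
private theorem removeNth_single_self_fb (j : Fin (n + 1)) (u : Space) :
    j.removeNth (Pi.single j u : Config (n + 1)) = 0 := by
  funext i
  simp [Fin.removeNth, Fin.succAbove_ne]

/-- Dropping particle `j` turns a displacement of particle `j.succAbove i` into one of particle
`i`. [folklore] -/
private theorem removeNth_single_succAbove_fb (j : Fin (n + 1)) (i : Fin n) (u : Space) :
    j.removeNth (Pi.single (j.succAbove i) u : Config (n + 1)) = Pi.single i u := by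
  funext i'
  simp [Fin.removeNth, Pi.single_apply]

/-- **The derivative of `a†(φ)Φ`** (product and chain rules on the finite sum):
`D(a†Φ)(X) = (√(n+1))⁻¹ ∑_j (φ(x_j) DΦ(X̂_j) ∘ R_j + Φ(X̂_j) Dφ(x_j) ∘ π_j)`. [folklore] -/
theorem hasFDerivAt_modeCr {φ : Space → ℂ} (hφ : Differentiable ℝ φ) {Φ : Config n → ℂ}
    (hΦ : Differentiable ℝ Φ) (X : Config (n + 1)) :
    HasFDerivAt (modeCr φ Φ) (((Real.sqrt (n + 1) : ℝ) : ℂ)⁻¹ • ∑ j : Fin (n + 1),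
      (φ (X j) • (fderiv ℝ Φ (j.removeNth X)).comp (removeNthCLM j) +
        Φ (j.removeNth X) • (fderiv ℝ φ (X j)).comp (ContinuousLinearMap.proj j))) X := by
  have h : ∀ j ∈ (Finset.univ : Finset (Fin (n + 1))),
      HasFDerivAt (fun X : Config (n + 1) => φ (X j) * Φ (j.removeNth X))
        (φ (X j) • (fderiv ℝ Φ (j.removeNth X)).comp (removeNthCLM j) +
          Φ (j.removeNth X) • (fderiv ℝ φ (X j)).comp (ContinuousLinearMap.proj j)) X := by
    intro j _
    have h1 : HasFDerivAt (fun X : Config (n + 1) => φ (X j))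
        ((fderiv ℝ φ (X j)).comp (ContinuousLinearMap.proj j)) X :=
      (hφ (X j)).hasFDerivAt.comp X (hasFDerivAt_apply j X)
    have h2 : HasFDerivAt (fun X : Config (n + 1) => Φ (j.removeNth X))
        ((fderiv ℝ Φ (j.removeNth X)).comp (removeNthCLM j)) X :=
      (hΦ (j.removeNth X)).hasFDerivAt.comp X (removeNthCLM j).hasFDerivAt
    exact h1.mul h2
  exact (HasFDerivAt.fun_sum h).const_mul _

/-- The directional derivatives of `a†(φ)Φ`:
`∂_v(a†Φ)(X) = (√(n+1))⁻¹ ∑_j (φ(x_j) ∂_{v̂_j}Φ(X̂_j) + Φ(X̂_j) ∂_{v_j}φ(x_j))`. [folklore] -/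
theorem fderiv_modeCr_apply {φ : Space → ℂ} (hφ : Differentiable ℝ φ) {Φ : Config n → ℂ}
    (hΦ : Differentiable ℝ Φ) (X v : Config (n + 1)) :
    fderiv ℝ (modeCr φ Φ) X v = ((Real.sqrt (n + 1) : ℝ) : ℂ)⁻¹ * ∑ j : Fin (n + 1),
      (φ (X j) * fderiv ℝ Φ (j.removeNth X) (j.removeNth v) +
        Φ (j.removeNth X) * fderiv ℝ φ (X j) (v j)) := by
  rw [(hasFDerivAt_modeCr hφ hΦ X).fderiv]
  simp only [smul_apply, sum_apply, add_apply, ContinuousLinearMap.coe_comp, Function.comp_apply,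
    removeNthCLM_apply, ContinuousLinearMap.proj_apply, smul_eq_mul]

/-- `∑_c |∂_c φ_k(x)|² = L⁻³ ‖p‖²`, `p = 2πk/L` (`∂_c φ_k = (2πi k_c/L) φ_k`, `|φ_k| = L^{-3/2}`).
[folklore] -/
theorem sum_nnnorm_fderiv_planeWaveMode_sq (hL : 0 < L) (k : Fin 3 → ℤ) (x : Space) :
    ∑ c : Fin 3, ((‖fderiv ℝ (planeWaveMode L k) x (EuclideanSpace.single c (1 : ℝ))‖₊ : ℝ≥0∞)) ^ 2 =
      (ENNReal.ofReal L ^ 3)⁻¹ * ENNReal.ofReal (‖latticeVec (2 * Real.pi / L) k‖ ^ 2) := by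
  have hφ : planeWaveMode L k = fun x => ((Real.sqrt (L ^ 3))⁻¹ : ℂ) * cellWave L k x :=
    funext (planeWaveMode_eq L k)
  have hdiff : Differentiable ℝ (cellWave L k) :=
    ((contDiff_cellWave L k).of_le (mod_cast le_top) : ContDiff ℝ 1 _).differentiable one_ne_zero
  have hd : ∀ c : Fin 3, ‖fderiv ℝ (planeWaveMode L k) x (EuclideanSpace.single c (1 : ℝ))‖ ^ 2 =
      (L ^ 3)⁻¹ * (2 * Real.pi / L * (k c : ℝ)) ^ 2 := by
    intro c
    rw [hφ, fderiv_const_mul (hdiff x), smul_apply, smul_eq_mul, fderiv_cellWave_apply_single]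
    have hI : (2 * (Real.pi : ℂ) * Complex.I * ((k c : ℤ) : ℂ) / (L : ℂ)) =
        ((2 * Real.pi / L * (k c : ℝ) : ℝ) : ℂ) * Complex.I := by
      push_cast
      ring
    rw [hI, norm_mul, norm_mul, norm_mul, norm_inv, Complex.norm_real, Complex.norm_real,
      Complex.norm_I, mul_one, norm_cellWave, mul_one, Real.norm_of_nonneg (Real.sqrt_nonneg _),
      Real.norm_eq_abs, mul_pow, inv_pow, Real.sq_sqrt (by positivity), sq_abs]
  simp only [coe_nnnorm_sq_eq_ofReal, hd]
  rw [← ENNReal.ofReal_sum_of_nonneg fun _ _ => by positivity, ← Finset.mul_sum,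
    ENNReal.ofReal_mul (by positivity), ENNReal.ofReal_inv_of_pos (by positivity),
    ENNReal.ofReal_pow hL.le, EuclideanSpace.norm_sq_eq]
  congr 2
  refine Finset.sum_congr rfl fun c _ => ?_
  rw [Real.norm_eq_abs, sq_abs]
  rfl

/-- **Pointwise kinetic bound for `a†Φ`** (Cauchy–Schwarz on the `n+1` terms of each partial
derivative: for `∂_{i,c}` the term `j = i` is `∂_cφ(x_i) Φ(X̂_i)`, the terms `j ≠ i` are
`φ(x_j) ∂_{i',c}Φ(X̂_j)` with `i = j.succAbove i'`):
`|∇(a†Φ)(X)|² ≤ L⁻³ ∑_j (‖p‖² |Φ(X̂_j)|² + |∇Φ(X̂_j)|²)`. [folklore] -/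
theorem kineticDensity_modeCr_le (hL : 0 < L) (k : Fin 3 → ℤ) {Φ : Config n → ℂ}
    (hΦ : Differentiable ℝ Φ) (X : Config (n + 1)) :
    kineticDensity (modeCr (planeWaveMode L k) Φ) X ≤ (ENNReal.ofReal L ^ 3)⁻¹ *
      ∑ j : Fin (n + 1), (ENNReal.ofReal (‖latticeVec (2 * Real.pi / L) k‖ ^ 2) *
        ((‖Φ (j.removeNth X)‖₊ : ℝ≥0∞)) ^ 2 + kineticDensity Φ (j.removeNth X)) := by
  have hφd : Differentiable ℝ (planeWaveMode L k) :=
    ((contDiff_planeWaveMode L k).of_le (mod_cast le_top) : ContDiff ℝ 1 _).differentiable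
      one_ne_zero
  -- the unit displacements and the two kinds of terms
  set e : Fin (n + 1) → Fin 3 → Config (n + 1) := fun i c =>
    Pi.single i (EuclideanSpace.single c (1 : ℝ)) with he
  set A : Fin (n + 1) → Fin 3 → Fin (n + 1) → ℝ≥0∞ := fun i c j =>
    ((‖Φ (j.removeNth X)‖₊ : ℝ≥0∞)) ^ 2 *
      ((‖fderiv ℝ (planeWaveMode L k) (X j) (e i c j)‖₊ : ℝ≥0∞)) ^ 2 with hA
  set B : Fin (n + 1) → Fin 3 → Fin (n + 1) → ℝ≥0∞ := fun i c j => (ENNReal.ofReal L ^ 3)⁻¹ *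
    ((‖fderiv ℝ Φ (j.removeNth X) (j.removeNth (e i c))‖₊ : ℝ≥0∞)) ^ 2 with hB
  -- Step 1: each partial derivative, Cauchy–Schwarz on the `n+1` terms (one summand of each term vanishes)
  have h1 : ∀ (i : Fin (n + 1)) (c : Fin 3),
      ((‖fderiv ℝ (modeCr (planeWaveMode L k) Φ) X (e i c)‖₊ : ℝ≥0∞)) ^ 2 ≤
        ∑ j : Fin (n + 1), (A i c j + B i c j) := by
    intro i c
    have h0 : (n + 1 : ℝ≥0∞) ≠ 0 := by simp
    rw [← ENNReal.mul_le_mul_iff_right h0 (by simp), fderiv_modeCr_apply hφd hΦ,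
      cast_succ_mul_nnnorm_inv_sqrt_mul_sq]
    refine (nnnorm_sum_sq_le _ _).trans ?_
    rw [Finset.card_univ, Fintype.card_fin]
    push_cast
    refine mul_le_mul_right (Finset.sum_le_sum fun j _ => ?_) _
    rcases eq_or_ne j i with rfl | hji
    · have hz : j.removeNth (e j c) = 0 := removeNth_single_self_fb j _
      rw [hz, map_zero, mul_zero, zero_add, nnnorm_mul, ENNReal.coe_mul, mul_pow]
      exact le_self_add
    · have hz : e i c j = 0 := by simp [he, hji]
      rw [hz, map_zero, mul_zero, add_zero, nnnorm_mul, ENNReal.coe_mul, mul_pow,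
        coe_nnnorm_planeWaveMode_sq hL]
      exact le_add_self
  -- Step 2: the `A`-terms summed over `(i, c)`: only `i = j` survives
  have hAsum : ∀ j : Fin (n + 1), ∑ i : Fin (n + 1), ∑ c : Fin 3, A i c j =
      (ENNReal.ofReal L ^ 3)⁻¹ * ENNReal.ofReal (‖latticeVec (2 * Real.pi / L) k‖ ^ 2) *
        ((‖Φ (j.removeNth X)‖₊ : ℝ≥0∞)) ^ 2 := by
    intro j
    rw [Fin.sum_univ_succAbove _ j]
    have hoff : ∀ i' : Fin n, ∑ c : Fin 3, A (j.succAbove i') c j = 0 := fun i' => by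
      refine Finset.sum_eq_zero fun c _ => ?_
      have hz : e (j.succAbove i') c j = 0 := by simp [he]
      simp [hA, hz]
    simp only [hoff, Finset.sum_const_zero, add_zero]
    simp only [hA]
    rw [← Finset.mul_sum]
    simp only [he, Pi.single_eq_same]
    rw [sum_nnnorm_fderiv_planeWaveMode_sq hL, mul_comm]
  -- Step 3: the `B`-terms summed over `(i, c)`: `i = j` vanishes, `i = j.succAbove i'` gives `∂_{i',c}Φ(X̂_j)`
  have hBsum : ∀ j : Fin (n + 1), ∑ i : Fin (n + 1), ∑ c : Fin 3, B i c j =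
      (ENNReal.ofReal L ^ 3)⁻¹ * kineticDensity Φ (j.removeNth X) := by
    intro j
    rw [Fin.sum_univ_succAbove _ j]
    have hdiag : ∑ c : Fin 3, B j c j = 0 := Finset.sum_eq_zero fun c _ => by
      simp [hB, he, removeNth_single_self_fb]
    rw [hdiag, zero_add, kineticDensity, Finset.mul_sum]
    refine Finset.sum_congr rfl fun i' _ => ?_
    rw [Finset.mul_sum]
    refine Finset.sum_congr rfl fun c _ => ?_
    simp only [hB, he, removeNth_single_succAbove_fb]
  -- assembling
  calc kineticDensity (modeCr (planeWaveMode L k) Φ) X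
      = ∑ i : Fin (n + 1), ∑ c : Fin 3,
          ((‖fderiv ℝ (modeCr (planeWaveMode L k) Φ) X (e i c)‖₊ : ℝ≥0∞)) ^ 2 := rfl
    _ ≤ ∑ i : Fin (n + 1), ∑ c : Fin 3, ∑ j : Fin (n + 1), (A i c j + B i c j) :=
        Finset.sum_le_sum fun i _ => Finset.sum_le_sum fun c _ => h1 i c
    _ = ∑ j : Fin (n + 1), ((∑ i : Fin (n + 1), ∑ c : Fin 3, A i c j) +
          ∑ i : Fin (n + 1), ∑ c : Fin 3, B i c j) := by
        have hc : ∀ i : Fin (n + 1), ∑ c : Fin 3, ∑ j : Fin (n + 1), (A i c j + B i c j) =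
            ∑ j : Fin (n + 1), ∑ c : Fin 3, (A i c j + B i c j) := fun i => Finset.sum_comm
        simp only [hc]
        rw [Finset.sum_comm]
        simp only [Finset.sum_add_distrib]
    _ = (ENNReal.ofReal L ^ 3)⁻¹ * ∑ j : Fin (n + 1),
          (ENNReal.ofReal (‖latticeVec (2 * Real.pi / L) k‖ ^ 2) *
            ((‖Φ (j.removeNth X)‖₊ : ℝ≥0∞)) ^ 2 + kineticDensity Φ (j.removeNth X)) := by
        simp only [hAsum, hBsum, Finset.mul_sum, mul_add, mul_assoc]

/-- **Kinetic half of B9**: `∫|∇(a†Φ)|² ≤ (n+1)(∫|∇Φ|² + ‖p‖² ‖Φ‖²)` for a `C¹` `n`-body `Φ`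
(integrate the pointwise bound; each of the `n+1` relabelled terms integrates to `L³ ∫_Y`). [folklore] -/
theorem lintegral_kineticDensity_modeCr_le (hL : 0 < L) (k : Fin 3 → ℤ) {Φ : Config n → ℂ}
    (hΦ : ContDiff ℝ 1 Φ) :
    ∫⁻ X in cellN (n + 1) L, kineticDensity (modeCr (planeWaveMode L k) Φ) X ≤
      (n + 1 : ℝ≥0∞) * ((∫⁻ Y in cellN n L, kineticDensity Φ Y) +
        ENNReal.ofReal (‖latticeVec (2 * Real.pi / L) k‖ ^ 2) * normSq L Φ) := by
  have hV : ENNReal.ofReal L ^ 3 ≠ 0 := pow_ne_zero _ (ENNReal.ofReal_pos.2 hL).ne'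
  have hV' : ENNReal.ofReal L ^ 3 ≠ ⊤ := ENNReal.pow_ne_top ENNReal.ofReal_ne_top
  set P := ENNReal.ofReal (‖latticeVec (2 * Real.pi / L) k‖ ^ 2) with hP
  have hΦ2 : Measurable fun Y : Config n => ((‖Φ Y‖₊ : ℝ≥0∞)) ^ 2 :=
    (hΦ.continuous.measurable.nnnorm.coe_nnreal_ennreal).pow_const _
  have hPΦ : Measurable fun Y : Config n => P * ((‖Φ Y‖₊ : ℝ≥0∞)) ^ 2 := hΦ2.const_mul _
  have hG : Measurable fun Y : Config n => P * ((‖Φ Y‖₊ : ℝ≥0∞)) ^ 2 + kineticDensity Φ Y :=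
    hPΦ.add (measurable_kineticDensity_fb Φ)
  have hGj : ∀ j : Fin (n + 1), Measurable fun X : Config (n + 1) =>
      P * ((‖Φ (j.removeNth X)‖₊ : ℝ≥0∞)) ^ 2 + kineticDensity Φ (j.removeNth X) := fun j =>
    hG.comp (continuous_removeNth j).measurable
  calc ∫⁻ X in cellN (n + 1) L, kineticDensity (modeCr (planeWaveMode L k) Φ) X
      ≤ ∫⁻ X in cellN (n + 1) L, (ENNReal.ofReal L ^ 3)⁻¹ * ∑ j : Fin (n + 1),
          (P * ((‖Φ (j.removeNth X)‖₊ : ℝ≥0∞)) ^ 2 + kineticDensity Φ (j.removeNth X)) :=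
        lintegral_mono fun X => kineticDensity_modeCr_le hL k (hΦ.differentiable one_ne_zero) X
    _ = (ENNReal.ofReal L ^ 3)⁻¹ * ∑ j : Fin (n + 1), (ENNReal.ofReal L ^ 3 *
          ∫⁻ Y in cellN n L, (P * ((‖Φ Y‖₊ : ℝ≥0∞)) ^ 2 + kineticDensity Φ Y)) := by
        rw [lintegral_const_mul' _ _ (ENNReal.inv_ne_top.2 hV),
          lintegral_finsetSum _ fun j _ => hGj j]
        congr 1
        refine Finset.sum_congr rfl fun j _ => ?_
        exact lintegral_cellN_comp_removeNth hG j
    _ = (n + 1 : ℝ≥0∞) * ((∫⁻ Y in cellN n L, kineticDensity Φ Y) + P * normSq L Φ) := by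
        rw [Finset.sum_const, Finset.card_univ, Fintype.card_fin, nsmul_eq_mul, mul_left_comm,
          ← mul_assoc (ENNReal.ofReal L ^ 3)⁻¹, ENNReal.inv_mul_cancel hV hV', one_mul,
          lintegral_add_left hPΦ, lintegral_const_mul _ hΦ2]
        unfold normSq
        push_cast
        ring

/-- B9: form-boundedness of `a†`: `𝓔_{n+1}[a†Φ] ≤ (n+1)(𝓔_n[Φ] + (‖p‖² + n‖w‖₁/L³)‖Φ‖²)` for integrable `w`
(crude Cauchy–Schwarz on the `n+1` terms; `|φ|² = L⁻³`, `∫_cell w^per(x - c)dx = ‖w‖₁`). -/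
theorem qform_modeCr_le (hL : 0 < L) {w : ℝ → ℝ≥0∞} (hw : Measurable w) (hint : (∫⁻ x : Space, w ‖x‖) ≠ ⊤)
    (k : Fin 3 → ℤ) {Φ : Config n → ℂ} (hΦ : IsCore L Φ) :
    qform w L (modeCr (planeWaveMode L k) Φ) ≤ (n + 1 : ℝ≥0∞) * (qform w L Φ +
      ENNReal.ofReal (‖latticeVec (2 * Real.pi / L) k‖ ^ 2 + n * (∫⁻ x : Space, w ‖x‖).toReal / L ^ 3) *
        normSq L Φ) := by
  have hconv : (ENNReal.ofReal L ^ 3)⁻¹ * ((n : ℝ≥0∞) * ∫⁻ x : Space, w ‖x‖) =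
      ENNReal.ofReal (n * (∫⁻ x : Space, w ‖x‖).toReal / L ^ 3) := by
    rw [ENNReal.ofReal_div_of_pos (by positivity), ENNReal.ofReal_mul (Nat.cast_nonneg _),
      ENNReal.ofReal_natCast, ENNReal.ofReal_toReal hint, ENNReal.ofReal_pow hL.le,
      ENNReal.div_eq_inv_mul]
  rw [qform_eq_lintegral_kineticDensity_add_potForm, qform_eq_lintegral_kineticDensity_add_potForm,
    ENNReal.ofReal_add (by positivity) (by positivity), ← hconv]
  calc (∫⁻ X in cellN (n + 1) L, kineticDensity (modeCr (planeWaveMode L k) Φ) X) +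
        potForm w L (modeCr (planeWaveMode L k) Φ)
      ≤ (n + 1 : ℝ≥0∞) * ((∫⁻ Y in cellN n L, kineticDensity Φ Y) +
          ENNReal.ofReal (‖latticeVec (2 * Real.pi / L) k‖ ^ 2) * normSq L Φ) +
        (n + 1 : ℝ≥0∞) * (potForm w L Φ +
          (ENNReal.ofReal L ^ 3)⁻¹ * ((n : ℝ≥0∞) * ∫⁻ z : Space, w ‖z‖) * normSq L Φ) :=
        add_le_add (lintegral_kineticDensity_modeCr_le hL k hΦ.contDiff)
          (potForm_modeCr_le hL hw k hΦ.contDiff.continuous)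
    _ = _ := by ring

end Summit.AtomisticToContinuum.BoseEinsteinCondensation.Cruxes.PeriodicIRBound.LinearPhFloorWagner.WF

end

namespace Summit.AtomisticToContinuum.BoseEinsteinCondensation.Cruxes.PeriodicIRBound.LinearPhFloorWagner

/-- The registered sub-goal `stub_wfFormBounds2` of the crux ledger: this file's headline lemma `WF.qform_modeCr_le`. -/
theorem stub_wfFormBounds2 : WF.Pkg.FormBounds2 :=
  @WF.qform_modeCr_le

end Summit.AtomisticToContinuum.BoseEinsteinCondensation.Cruxes.PeriodicIRBound.LinearPhFloorWagner
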